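import Summits.RiemannHypothesis.RiemannHypothesis.Theorems.PfPersistenceF1TemplateLandau
import Literature.NumberTheory.LFunctions.ZetaFirstZeroCertificate

/-!
# PF persistence, fake seat 1 — THEOREM F1-T₁, hypothesis-minimal form

Unit `pub-rhpf-fake-1` of the `pub-rhpf` cell (mechanism / rigidity campaign; **no RH claims**);
FAKES §1.8.3′.  The zero `ρ₀` with `Re ρ₀ ≥ 1/2` required by
`TemplateLandau.frequently_pos_and_neg` is supplied by the tree's kernel-certified first zero
`1/2 + iγ`, `γ ∈ [225/16, 227/16]` (`Literature.NumberTheory.LFunctions.exists_zero_Icc_first_bracket`),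
so the only remaining hypothesis of the sign-change theorem for the template line density
`H_t = templateLD t` is the one of RULING A142 (A3): no zero of `ζ` with real part `≥ 1/2` has
ordinate `±t` (`templateLD_frequently_pos_and_neg`, with the quantitative two-sided form
`exists_frequently_lt_and_lt`: oscillations exceeding `±c` for every `c < 1/|γ − t|`).  Under
`RiemannHypothesis` (a HYPOTHESIS of a bookkeeping lemma — nothing is claimed about it) that
hypothesis is `ζ(1/2 ± it) ≠ 0` (`ordinates_ne_of_riemannHypothesis`); and if instead `ζ` has a
zero with real part `> 1/2` (RH false — again a HYPOTHESIS), `H_t` is unbounded in both directions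
(`unbounded_of_offline_zero`, THEOREM F1-T₂ (I) of FAKES §1.8.3″).
-/

set_option linter.dupNamespace false

noncomputable section

open Complex Filter Topology Set

namespace Summit.RiemannHypothesis.RiemannHypothesis.Theorems.PfPersistence.Fake1.TemplateLandau

open Literature.NumberTheory.LFunctions
open Summit.RiemannHypothesis.RiemannHypothesis.Theorems.PfPersistence.Fake1.TemplateMellin

/-- **THEOREM F1-T₁ (hypothesis-minimal, quantitative).**  If no zero of `ζ` with real part `≥ 1/2`
has ordinate `±t`, then — taking for `ρ₀` the kernel-certified first zero `1/2 + iγ`,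
`γ ∈ [225/16, 227/16]` (`exists_zero_Icc_first_bracket`) — for every `0 < c < 1/|γ − t|` the
template line density satisfies `H_t(x) > c` for arbitrarily large `x` and `H_t(x) < −c` for
arbitrarily large `x`. [folklore] -/
theorem exists_frequently_lt_and_lt {t : ℝ}
    (ht : ∀ ρ : ℂ, riemannZeta ρ = 0 → 1 / 2 ≤ ρ.re → ρ.im ≠ t ∧ ρ.im ≠ -t) :
    ∃ γ ∈ Icc (225 / 16 : ℝ) (227 / 16), γ ≠ t ∧ ∀ c : ℝ, 0 < c → c < 1 / |γ - t| →
      (∃ᶠ x in atTop, c < templateLD t x) ∧ (∃ᶠ x in atTop, templateLD t x < -c) := by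
  obtain ⟨γ, hγ, hz⟩ := exists_zero_Icc_first_bracket
  have hre : (1 / 2 + γ * I : ℂ).re = 1 / 2 := by simp
  have him : (1 / 2 + γ * I : ℂ).im = γ := by simp
  have hγt : γ ≠ t := by
    have h := (ht _ hz (by rw [hre])).1
    rwa [him] at h
  refine ⟨γ, hγ, hγt, fun c hc0 hc ↦ ?_⟩
  have hnorm : ‖(1 / 2 + γ * I : ℂ) - (1 / 2 + t * I)‖ = |γ - t| := by
    have h : (1 / 2 + γ * I : ℂ) - (1 / 2 + t * I) = ((γ - t : ℝ) : ℂ) * I := by push_cast; ring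
    rw [h, norm_mul, Complex.norm_I, mul_one, Complex.norm_real, Real.norm_eq_abs]
  obtain ⟨h1, h2⟩ := frequently_lt_and_lt hz (by rw [hre]) ht hc0 (by rwa [hnorm])
  simp only [hre, sub_self, Real.rpow_zero, mul_one] at h1 h2
  exact ⟨h1, h2⟩

/-- **THEOREM F1-T₁ (hypothesis-minimal): the template line density changes sign infinitely often**
whenever no zero of `ζ` with real part `≥ 1/2` has ordinate `±t` (the zero `ρ₀` of
`frequently_pos_and_neg` is supplied by the kernel-certified first zero on the critical line).
[folklore] -/
theorem templateLD_frequently_pos_and_neg {t : ℝ}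
    (ht : ∀ ρ : ℂ, riemannZeta ρ = 0 → 1 / 2 ≤ ρ.re → ρ.im ≠ t ∧ ρ.im ≠ -t) :
    (∃ᶠ x in atTop, 0 < templateLD t x) ∧ (∃ᶠ x in atTop, templateLD t x < 0) := by
  obtain ⟨γ, -, hz⟩ := exists_zero_Icc_first_bracket
  exact frequently_pos_and_neg hz (by simp) ht

/-- **F1-T₂ (I), kernel form: an off-line zero makes `H_t` unbounded in both directions.**  If `ζ`
has a zero `ρ₀` with `Re ρ₀ > 1/2` (i.e. RH fails — a HYPOTHESIS here, nothing is claimed) and no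
zero with real part `≥ 1/2` has ordinate `±t`, then `H_t(x) > K` for arbitrarily large `x` and
`H_t(x) < −K` for arbitrarily large `x`, for every `K`. [folklore] -/
theorem unbounded_of_offline_zero {t : ℝ} {ρ₀ : ℂ} (h0 : riemannZeta ρ₀ = 0) (hb : 1 / 2 < ρ₀.re)
    (ht : ∀ ρ : ℂ, riemannZeta ρ = 0 → 1 / 2 ≤ ρ.re → ρ.im ≠ t ∧ ρ.im ≠ -t) (K : ℝ) :
    (∃ᶠ x in atTop, K < templateLD t x) ∧ (∃ᶠ x in atTop, templateLD t x < -K) := by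
  have hγt := (ht ρ₀ h0 hb.le).1
  have hne : ρ₀ - (1 / 2 + t * I) ≠ 0 := by
    intro h
    have := congrArg Complex.im h
    simp at this
    exact hγt (by linarith)
  have hn : 0 < 1 / ‖ρ₀ - (1 / 2 + t * I)‖ := by positivity
  set c : ℝ := 1 / ‖ρ₀ - (1 / 2 + t * I)‖ / 2 with hc
  have hc0 : 0 < c := by positivity
  obtain ⟨h1, h2⟩ := frequently_lt_and_lt h0 hb.le ht (c := c) hc0 (by linarith)
  have hev : ∀ᶠ x : ℝ in atTop, K ≤ c * x ^ (ρ₀.re - 1 / 2) := by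
    have hlim : Tendsto (fun x : ℝ ↦ c * x ^ (ρ₀.re - 1 / 2)) atTop atTop :=
      (tendsto_rpow_atTop (by linarith)).const_mul_atTop hc0
    exact hlim.eventually_ge_atTop K
  refine ⟨(h1.and_eventually hev).mono fun x hx ↦ lt_of_le_of_lt hx.2 hx.1,
    (h2.and_eventually hev).mono fun x hx ↦ ?_⟩
  linarith [hx.1, hx.2]

/-- The RH reading of the hypothesis (A142 (A3)): under `RiemannHypothesis`, 'no zero with real part
`≥ 1/2` has ordinate `±t`' is just `ζ(1/2 + it) ≠ 0 ∧ ζ(1/2 − it) ≠ 0`.  (A conditional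
bookkeeping lemma; nothing is claimed about RH.) [folklore] -/
theorem ordinates_ne_of_riemannHypothesis (hRH : RiemannHypothesis) {t : ℝ}
    (h1 : riemannZeta (1 / 2 + t * I) ≠ 0) (h2 : riemannZeta (1 / 2 - t * I) ≠ 0) :
    ∀ ρ : ℂ, riemannZeta ρ = 0 → 1 / 2 ≤ ρ.re → ρ.im ≠ t ∧ ρ.im ≠ -t := by
  intro ρ hρ hb
  have htriv : ¬∃ n : ℕ, ρ = -2 * (n + 1) := by
    rintro ⟨n, hn⟩
    have h := congrArg Complex.re hn
    simp at h
    have hn0 : (0 : ℝ) ≤ n := n.cast_nonneg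
    linarith
  have hρ1 : ρ ≠ 1 := by
    intro h; rw [h] at hρ; exact riemannZeta_ne_zero_of_one_le_re (by simp) hρ
  have hre : ρ.re = 1 / 2 := hRH ρ hρ htriv hρ1
  constructor
  · intro him
    apply h1
    have : ρ = 1 / 2 + t * I := Complex.ext (by simp [hre]) (by simp [him])
    rwa [this] at hρ
  · intro him
    apply h2
    have : ρ = 1 / 2 - t * I := Complex.ext (by simp [hre]) (by simp [him])
    rwa [this] at hρ

/-- **Under RH** (conditional bookkeeping only): if `ζ(1/2 ± it) ≠ 0` then `H_t` changes sign
infinitely often. [folklore] -/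
theorem templateLD_frequently_pos_and_neg_of_riemannHypothesis (hRH : RiemannHypothesis) {t : ℝ}
    (h1 : riemannZeta (1 / 2 + t * I) ≠ 0) (h2 : riemannZeta (1 / 2 - t * I) ≠ 0) :
    (∃ᶠ x in atTop, 0 < templateLD t x) ∧ (∃ᶠ x in atTop, templateLD t x < 0) :=
  templateLD_frequently_pos_and_neg (ordinates_ne_of_riemannHypothesis hRH h1 h2)

end Summit.RiemannHypothesis.RiemannHypothesis.Theorems.PfPersistence.Fake1.TemplateLandau
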